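import Literature.MathematicalPhysics.QuantumFieldTheory.Balaban1983to89.B9Thm312WholeDir
import Literature.MathematicalPhysics.QuantumFieldTheory.Balaban1983to89.B9Thm313WholeBlocksNbrRec

/-!
# `Balaban1983to89.B9Thm313WholeDir` — [B9] Theorem 3.13 (p. 426): the reduction (3.153) of 𝔊 = 𝔓G₁ WITH THE DIRECTION LETTERS — the
# per-direction left entry ∇_{U,ν}𝔊 and the MIXED second-order member on print's direction-pair family ∇_{U,ν}𝔊∇\*_{U,μ} (letters of printed
# shape indexed by the direction; one member, one configuration)

T. Bałaban, *Propagators for lattice gauge theories in a background field*, Commun. Math. Phys. **99** (1985) 389–434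
[`Balaban1985BackgroundPropagators`, "B9"]; [4] = T. Bałaban, *Propagators and renormalization transformations for lattice
gauge theories. II*, Commun. Math. Phys. **96** (1984) 223–250 [`Balaban1984PropagatorsII`].

statement-level skeleton of published theorems with citation tags; proofs where landed; nothing here is a claim about the
Yang–Mills mass gap

THE PRINTED LOCI.  Theorem 3.13 p. 426: *"The formulas (3.147), (3.153) permit us to reduce properties of the operators 𝔓, 𝔊 to the
corresponding properties of the operators G′, (Q′G′²Q′\*)⁻¹, G₁, (QG₁Q\*)⁻¹"*; (3.152)–(3.153) p. 426; (3.39) p. 397 (*"max_{μ,ν}"*: every norm of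
a two-direction quantity runs over ALL direction pairs); (3.42), (3.46) pp. 397–398; Theorem 3.12 p. 423; (3.130) p. 421, (3.138) p. 423;
(3.132) p. 422; (3.126) p. 420; [4] (2.26) p. 228, (2.51)–(2.54) p. 232, Lemma 2.1 (2.60)–(2.61) p. 234.

WHY THIS FILE (successor work of the same seat; located point (O4′) of seats n06-k ∕ n06-d, pub-ymgap bus 2026-08-27).  The row-21 leaf of
record `…B9Thm313WholeLeafCompleteNbrRec.thm313Printed_completeNbrRec` reads the record's third L² member `K.l2 3` and the input members
`K.e4`, `K.h2` of 𝔊's kernel family through the ONE-SLOT composite `D U ∘ₗ (GG U ∘ₗ Dstar U)` of the bundled letters ∇_U, ∇\*_U, which at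
the record's coordinate pins carries only the DIAGONAL direction pairs.  THIS FILE types the reduction (3.153) — E𝔊F = EG₁F − (EG₁Dv)(RDv\*G₁F)
− (EG₁Q\*)(C₁QG₁F) — for the DIRECTION letters E = ∇_{U,ν} = `Dd U ν`, F = ∇\*_{U,μ} = `Dds U μ` (operators on the G-lattice X, the letters of
`…BlocksNbr.Thm33G0L2P` ∕ `…B9Thm312WholeDir`), with the G₁-pieces from Theorem 3.3 for G₀ per direction (`…B9Thm312WholeDir.Thm33G0Dir ∕
Thm33G0L2M ∕ StepDir`) and the direction-indexed twins of the sibling LETTERS: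
* §1 HYPOTHESIS SCHEMAS of printed shape (Prop structures; nothing asserted): `Thm33G0DirR` ((3.42)₃ for G₀∇\*_{U,μ} per direction — the
  right companion of `Thm33G0Dir.e1d`); `Letters313DM` (the per-direction twins of `B9Thm313WholeLeft.Letters313D.dgQs ∕ dgDH` and of
  `B9Thm312WholeHHolder.LettersHH.pQ`: ∇_νG₀Q\* : Z⁰ → 𝔠⁽¹⁾, ∇_νG₀Dv : `bH` → 𝔠⁽¹⁾, the Φ^X_β-probe of ∇_νG₀Q\*); `Letters313L2M` (the per-direction
  twins of `B9Thm313WholeL2G(P).Letters313L2(P).dGDv ∕ dGQs ∕ rgdDs`: block-L² bounds of ∇_νG₀Dv, ∇_νG₀Q\*, RDv\*G₁∇\*_μ); `Letters313IM` (the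
  X-input twins of `B9Thm313WholeInput.Letters313I`: RDv\*G₁∇\*_μ : `bHX ε → bHW ε`, ∇_νG₀Dv out of `bHW ε` and its Φ^X_β-probe, the step out
  of `bHW ε`, domination ∕ localisation of the X-input norms).
* §2 ★ `GG_entry1E_of_letters` — (3.153) differentiated on the left by a GENERIC left letter E (the abstraction of
  `B9Thm313WholeLeft.GG_entry1_of_letters` from ∇_U to any E : 𝔩(X) → 𝔩(V′); same eight compositions, constant `constD313 …`), and ★
  `GG_entry1d_of_letters` — (3.42)₂ for the component ∇_{U,ν}𝔊 : 𝔩(X) → 𝔩(X).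
* §3 ★ `GG_l2bd_mixed_of_letters` — the block-L² bound of ∇_{U,ν}𝔊∇\*_{U,μ} per pair (the twin of `B9Thm313WholeL2G.GG_l2bd_entry4` with the
  direction letters: the G₁-entries by r1's Neumann bookkeeping `entry_l2w_of_step`, the letters, `hasMaj_frakG_classes`, `E_GG_F_eq`;
  constant `constG46 (constKp B₂ B₄ θ c) c`, NO scale transfer), and ★ `GG_l2bd_mixedFamily_of_letters` (the package over P × P, n06-k
  `familyOp`, block map `blk ∘ Prod.fst`, constant √|P × P|·K).
The input members and the typed blocks ∕ leaf are the sequels `…B9Thm313WholeDirInput`, `…B9Thm313WholeBlocksPairM`, `…LeafCompletePairM`.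

HONEST SCOPE.  Nothing of [B9] or [4] is asserted: Theorem 3.3 for G₀ per direction, the steps, the letters, the identities and (2.60)–(2.61)
are HYPOTHESES of printed ∕ definitional shape (located gap G-B9-16); the content is bookkeeping, kernel-checked.  NOT a node discharge, NOT
summit progress; count-neutral; one finite lattice at a time; nothing continuum, nothing about the mass gap.  Cell `pub-ymgap` (HUMAN RULING
D-0062), Track A node N06 [B9], N06-ASSIGNMENT v1 row 21 (bundle F7), seat `pub-ymgap-dag-n06-l` (g6), 2026-08-27.
-/

namespace Literature.MathematicalPhysics.QuantumFieldTheory.Balaban1983to89.B9Thm313WholeDir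

open Literature.MathematicalPhysics.QuantumFieldTheory.Balaban1983to89
open Finset B6RandomWalk B6RandomWalkHom B9Thm34Ext B9Thm37GlueCor36 B11SectG B9SectDSup
open B9Thm37AllNorms B9Thm37AllNormsInstances B9FromB6 B9SectBStepWhole B9Thm312Whole B9Thm312WholeLeaf
open B9Thm312WholeLeft B9Thm313Whole B9Thm313WholeLeft
open B9Thm37Glue B9SectDL2Decay B9RWSums343Holder B9Ineq347 B9Thm312WholeClasses B9Thm312WholeL2
open B9Thm312WholeBlocksRel B9Thm312WholeBlocksNbr B9Thm312WholeHolder B9Thm312WholeHHolder B9Thm313WholeHolder B9Thm313WholeL2G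
open B9Thm313WholeL2GP B9RWSums346SecondDiff B9Thm312WholeDir

noncomputable section

section OneMember

variable {g : B9.Geometry} {B : B9.Backgrounds} {X Y Z W PX PY P : Type}
variable [Fintype X] [Fintype Y] [Fintype Z] [Fintype W] [Fintype PX] [Fintype PY] [Fintype P] [Fintype g.Site]
variable {R₀ : ℝ} {H₀ : Prop}

/-! ## §1 The direction-indexed letters (printed shape; nothing asserted) -/

/-- **THEOREM 3.3, ENTRY (3.42)₃ FOR G₀, PER DIRECTION** (p. 399: G₀ = G(U) *"satisfies the inequalities (3.42)–(3.47)"*; (3.39) p. 397): the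
component G₀∇\*_{U,μ} : 𝔩(X) → 𝔩(X) has the two-space sup majorant B₀Lʲη·e^{−δ₀d} (the right companion of `B9Thm312WholeDir.Thm33G0Dir.e1d`, the
direction twin of `B9Thm312Whole.Thm33G0.e2`).  A HYPOTHESIS SCHEMA; nothing asserted. [cite: Balaban1985BackgroundPropagators, Thm 3.3 p.399 + (3.42) p.397 + (3.39) p.397] -/
structure Thm33G0DirR (𝔬 : Ops g B X Y Z W) (Dds : B.Cfg → P → Module.End ℝ (X → ℝ)) (R₀ : ℝ) (H₀ : Prop) (B₀ δ₀ : ℝ)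
    (U : B.Cfg) : Prop where
  e2d : ∀ μ : P, HasMajorantHom (g := toB6 g R₀ H₀) 𝔬.blk 𝔬.blk (𝔬.G0 U ∘ₗ Dds U μ)
    (fun (a b : g.Site) => B₀ * g.len a * Real.exp (-(δ₀ * g.dist a b)))

/-- **THE SUP- AND PROBE-CLASS LETTERS OF THE REDUCTION, PER LEFT DIRECTION** — the direction twins of `B9Thm313WholeLeft.Letters313D.dgQs ∕ dgDH`
and `B9Thm312WholeHHolder.LettersHH.pQ` (there for the bundled ∇_U): `dgQsd ν` — ∇_{U,ν}G₀Q\* : Z⁰ → 𝔠⁽¹⁾ (an H₀-type entry of (3.126)); `dgDHd ν` —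
∇_{U,ν}G₀Dv out of the free W-Hölder class `bH` into 𝔠⁽¹⁾ (the gauge-mode derivative Dv of DvRDv\*, [4] (2.26); the twice-differentiated term read
from a Hölder input as in (3.44)); `pQd ν β` — the Φ^X_β-probe of ∇_{U,ν}G₀Q\* from Z⁰ into the probe class of weight (Lʲη)^{β−1}.  NOTHING ASSERTED:
these are the instance's (Theorem 3.3 for G₀, (3.126), (3.49)). [cite: Balaban1985BackgroundPropagators, Thm 3.13 p.426 + (3.126) p.420 + (3.42)–(3.44) pp.397–398 + (3.40) p.397 + (3.39) p.397; Balaban1984PropagatorsII, (2.26) p.228] -/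
structure Letters313DM (𝔬 : Ops g B X Y Z W) (𝔭 : HolderProbes g B X Y PX PY) (Dd : B.Cfg → P → Module.End ℝ (X → ℝ))
    (R₀ : ℝ) (H₀ : Prop) (hG : GeoOK g) (B₃ : ℝ) (Bq : ℝ → ℝ) (δ₃ : ℝ) (bH : BlockNorm (toB6 g R₀ H₀) (W → ℝ)) (U : B.Cfg) :
    Prop where
  dgQsd : ∀ ν : P, HasMaj (cNorm R₀ H₀ 𝔬.blkZ hG.lenle 0) (cNorm R₀ H₀ 𝔬.blk hG.lenle 1) (Dd U ν ∘ₗ 𝔬.G0 U ∘ₗ 𝔬.Qstar U)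
    (fun a b => B₃ * Real.exp (-(δ₃ * g.dist a b)))
  dgDHd : ∀ ν : P, HasMaj bH (cNorm R₀ H₀ 𝔬.blk hG.lenle 1) (Dd U ν ∘ₗ 𝔬.G0 U ∘ₗ 𝔬.Dv U)
    (fun a b => B₃ * Real.exp (-(δ₃ * g.dist a b)))
  pQd : ∀ (ν : P) (β : ℝ), 0 ≤ β → β < 1 → HasMaj (cNormR R₀ H₀ 𝔬.blkZ hG.lenle 0) (cNormR R₀ H₀ 𝔭.blkPX hG.lenle (β - 1))
    ((𝔭.ΦX U β ∘ₗ Dd U ν ∘ₗ 𝔬.G0 U) ∘ₗ 𝔬.Qstar U) (fun a b => Bq β * Real.exp (-(δ₃ * g.dist a b)))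

/-- **THE BLOCK-L² LETTERS OF THE REDUCTION, PER DIRECTION** — the direction twins of `B9Thm313WholeL2G.Letters313L2.dGDv ∕ dGQs ∕ rgdDs`
(there for the bundled ∇_U, ∇\*_U), in the convention of (3.46) with the scale powers split as p. 398 allows: `dGDvd ν` — ∇_{U,ν}G₀Dv (W → X, factor
1); `dGQsd ν` — ∇_{U,ν}G₀Q\* (Z → X, factor L^{j′}η); `rgdDd μ` — RDv\*G₁∇\*_{U,μ} = RG′Dv\*∇\*_{U,μ} (X → W, factor 1; (3.152), Theorem 3.1 for G′ and
(3.49) for R).  NOTHING ASSERTED: these are the instance's. [cite: Balaban1985BackgroundPropagators, Thm 3.13 p.426 + (3.152)–(3.153) p.426 + (3.46) p.398 + (3.39) p.397 + p.398 (remark after (3.47)); Balaban1984PropagatorsII, (2.26) p.228] -/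
structure Letters313L2M (𝔬 : Ops g B X Y Z W) (Dd Dds : B.Cfg → P → Module.End ℝ (X → ℝ)) (R₀ : ℝ) (H₀ : Prop) (B₄ δ : ℝ)
    (U : B.Cfg) : Prop where
  dGDvd : ∀ ν : P, BlockBd (g := toB6 g R₀ H₀) 𝔬.blkW 𝔬.blk (Dd U ν ∘ₗ 𝔬.G0 U ∘ₗ 𝔬.Dv U)
    (fun (y y' : g.Site) => B₄ * Real.exp (-(δ * g.dist y y')))
  dGQsd : ∀ ν : P, BlockBd (g := toB6 g R₀ H₀) 𝔬.blkZ 𝔬.blk (Dd U ν ∘ₗ 𝔬.G0 U ∘ₗ 𝔬.Qstar U)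
    (fun (y y' : g.Site) => B₄ * g.len y' * Real.exp (-(δ * g.dist y y')))
  rgdDd : ∀ μ : P, BlockBd (g := toB6 g R₀ H₀) 𝔬.blk 𝔬.blkW (𝔬.R U ∘ₗ 𝔬.Dvstar U ∘ₗ 𝔬.G1 U ∘ₗ Dds U μ)
    (fun (y y' : g.Site) => B₄ * Real.exp (-(δ * g.dist y y')))

/-- **THE INPUT-CLASS LETTERS OF THE REDUCTION, X-INPUTS, PER DIRECTION** — the twins of `B9Thm313WholeInput.Letters313I` for inputs on the
G-lattice X (the input Hölder norms `bHX ε` of n06-k's v4 species) and the direction letters: `rgdd μ ε` — RDv\*G₁∇\*_{U,μ} : `bHX ε → bHW ε`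
((3.152); Theorem 3.1 for G′ and (3.49) for R); `dgDvd ν ε` — ∇_{U,ν}G₀Dv : `bHW ε →` block sup, constant B_d(ε), and `pdgDvd ν ε β` — its Φ^X_β-probe
from `bHW (β+ε)`, B_d2(ε,β)(Lʲη)^{−β} (the (3.44) ∕ (3.45)-type entries of Theorem 3.3's G₀ with the gauge-mode derivative Dv, [4] (2.26)); `tDv ε` — the
perturbation step (Δ′_π + Δ⁽²⁾_π)G₀Dv : `bHW ε → 𝔠⁽¹⁾`, θ_v·e^{−δ_K d} (verbatim `Letters313I.tDv`); `domX`, `locX` — the input norms ‖λ‖_ε + |λ| dominate |λ|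
on the block and are block-localised ((3.41), [4] (2.51)–(2.52)).  NOTHING ASSERTED: these are the instance's.
[cite: Balaban1985BackgroundPropagators, Thm 3.13 p.426 + (3.152)–(3.153) p.426 + (3.44)–(3.45) p.398 + (3.39)–(3.41) p.397 + (3.130)–(3.131) pp.421–422; Balaban1984PropagatorsII, (2.26) p.228 + (2.51)–(2.52) p.232] -/
structure Letters313IM (𝔬 : Ops g B X Y Z W) (𝔭 : HolderProbes g B X Y PX PY) (Dd Dds : B.Cfg → P → Module.End ℝ (X → ℝ))
    (R₀ : ℝ) (H₀ : Prop) (hlen : ∀ y : g.Site, 0 ≤ g.len y) (bHX : ℝ → BlockNorm (toB6 g R₀ H₀) (X → ℝ))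
    (bHW : ℝ → BlockNorm (toB6 g R₀ H₀) (W → ℝ)) (Br θv : ℝ) (Bd : ℝ → ℝ) (Bd2 : ℝ → ℝ → ℝ) (δ₃ δK : ℝ)
    (U : B.Cfg) : Prop where
  rgdd : ∀ (μ : P) (ε : ℝ), 0 < ε → HasMaj (bHX ε) (bHW ε) (𝔬.R U ∘ₗ 𝔬.Dvstar U ∘ₗ 𝔬.G1 U ∘ₗ Dds U μ)
    (fun a b => Br * Real.exp (-(δ₃ * g.dist a b)))
  dgDvd : ∀ (ν : P) (ε : ℝ), 0 < ε → ε ≤ 1 → HasMaj (bHW ε) (BlockNorm.ofBlocks (toB6 g R₀ H₀) 𝔬.blk)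
    (Dd U ν ∘ₗ (𝔬.G0 U ∘ₗ 𝔬.Dv U)) (fun (a b : g.Site) => Bd ε * Real.exp (-(δ₃ * g.dist a b)))
  pdgDvd : ∀ (ν : P) (ε β : ℝ), 0 < ε → ε ≤ 1 → 0 ≤ β → β < 1 → HasMaj (bHW (β + ε)) (BlockNorm.ofBlocks (toB6 g R₀ H₀) 𝔭.blkPX)
    ((𝔭.ΦX U β ∘ₗ Dd U ν) ∘ₗ (𝔬.G0 U ∘ₗ 𝔬.Dv U))
    (fun (a b : g.Site) => Bd2 ε β * g.len a ^ (-β) * Real.exp (-(δ₃ * g.dist a b)))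
  tDv : ∀ ε : ℝ, 0 < ε → HasMaj (bHW ε) (cNormR R₀ H₀ 𝔬.blk hlen 1) ((𝔬.Tpi U + 𝔬.T2 U) ∘ₗ (𝔬.G0 U ∘ₗ 𝔬.Dv U))
    (fun a b => θv * Real.exp (-(δK * g.dist a b)))
  domX : ∀ ε : ℝ, 0 < ε → ∀ (y : g.Site) (μ : X → ℝ), (BlockNorm.ofBlocks (toB6 g R₀ H₀) 𝔬.blk).loc y μ ≤ (bHX ε).loc y μ
  locX : ∀ ε : ℝ, 0 < ε → ∀ (y : g.Site) (μ : X → ℝ),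
    (bHX ε).IsLoc y μ → (BlockNorm.ofBlocks (toB6 g R₀ H₀) 𝔬.blk).IsLoc y μ

omit [Fintype Z] [Fintype W] [Fintype PX] [Fintype PY] [Fintype P] in
/-- Rates of the direction-indexed L² schema: Theorem 3.3's block-L² bounds at (B₂, δ₁) hold at every smaller rate δ₁′ ≦ δ₁ (B₂ ≧ 0, d ≧ 0)
(the twin of `B9Thm313WholeL2GP.thm33G0L2P_mono`). [cite: Balaban1985BackgroundPropagators, (3.46) p.398 (bookkeeping)] -/
theorem thm33G0L2M_mono {𝔬 : Ops g B X Y Z W} {Dd Dds : B.Cfg → P → Module.End ℝ (X → ℝ)} {B₂ δ₁ δ₁' : ℝ} {U : B.Cfg}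
    (hG : GeoOK g) (hB₂ : 0 ≤ B₂) (hδ : δ₁' ≤ δ₁) (h : Thm33G0L2M 𝔬 Dd Dds R₀ H₀ B₂ δ₁ U) :
    Thm33G0L2M 𝔬 Dd Dds R₀ H₀ B₂ δ₁' U := by
  have hexp : ∀ y y' : g.Site, Real.exp (-(δ₁ * g.dist y y')) ≤ Real.exp (-(δ₁' * g.dist y y')) := fun y y' =>
    Real.exp_le_exp.mpr (neg_le_neg (mul_le_mul_of_nonneg_right hδ (hG.dnn y y')))
  have hl : ∀ y : g.Site, 0 ≤ g.len y := hG.lenle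
  have hP := thm33G0L2P_mono (R₀ := R₀) (H₀ := H₀) hG hB₂ hδ h.toThm33G0L2P
  exact
    { l0 := hP.l0
      l1 := hP.l1
      l2 := hP.l2
      l3 := hP.l3
      l4 := hP.l4
      l5 := hP.l5
      l1d := fun ν => (h.l1d ν).mono fun y y' => mul_le_mul_of_nonneg_left (hexp y y') (mul_nonneg hB₂ (hl y'))
      l2d := fun μ => (h.l2d μ).mono fun y y' => mul_le_mul_of_nonneg_left (hexp y y') (mul_nonneg hB₂ (hl y))
      l4m := fun q => (h.l4m q).mono fun y y' => mul_le_mul_of_nonneg_left (hexp y y') hB₂ }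

omit [Fintype Y] [Fintype PX] [Fintype PY] [Fintype P] in
/-- the direction-indexed L² letters at a slower rate (e^{−δd} ≦ e^{−δ′d} for δ′ ≦ δ, d ≧ 0) (the twin of `letters313L2P_mono`).
[cite: Balaban1985BackgroundPropagators, (3.46) p.398 (bookkeeping)] -/
theorem letters313L2M_mono {𝔬 : Ops g B X Y Z W} {Dd Dds : B.Cfg → P → Module.End ℝ (X → ℝ)} {B₄ δ δ' : ℝ} {U : B.Cfg}
    (hG : GeoOK g) (hB₄ : 0 ≤ B₄) (hδ : δ' ≤ δ) (h : Letters313L2M 𝔬 Dd Dds R₀ H₀ B₄ δ U) :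
    Letters313L2M 𝔬 Dd Dds R₀ H₀ B₄ δ' U := by
  have hexp : ∀ y y' : g.Site, Real.exp (-(δ * g.dist y y')) ≤ Real.exp (-(δ' * g.dist y y')) := fun y y' =>
    Real.exp_le_exp.mpr (neg_le_neg (mul_le_mul_of_nonneg_right hδ (hG.dnn y y')))
  have hl : ∀ y : g.Site, 0 ≤ g.len y := hG.lenle
  exact
    { dGDvd := fun ν => (h.dGDvd ν).mono fun y y' => mul_le_mul_of_nonneg_left (hexp y y') hB₄
      dGQsd := fun ν => (h.dGQsd ν).mono fun y y' => mul_le_mul_of_nonneg_left (hexp y y') (mul_nonneg hB₄ (hl y'))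
      rgdDd := fun μ => (h.rgdDd μ).mono fun y y' => mul_le_mul_of_nonneg_left (hexp y y') hB₄ }

/-! ## §2 (3.153) differentiated on the left by a generic letter; the component ∇_{U,ν}𝔊 -/

/-- ★ **THEOREM 3.13, A LEFT ENTRY E𝔊 WITH A GENERIC LEFT LETTER, PRINTED SHAPE** (the abstraction of `B9Thm313WholeLeft.GG_entry1_of_letters` from
∇_U to any E : 𝔩(X) → 𝔩(V′) with block map `blkE`): from Theorem 3.3's (3.42)₁ (`he0`) for G₀ and the E-entry of G₀ (`he1E`, majorant
B₀Lʲη·e^{−δ₀d}), the step K′₁ = G₀(Δ′_π + Δ⁽²⁾_π) on 𝔠⁽²⁾ (`hK`, θc < 1) and its E-derivative E∘G₀∘T₁ : 𝔠⁽²⁾ → 𝔠_E⁽¹⁾ (`hKE`, θ′), the letters `gD2`,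
`gQs2`, `rgd2`, `c1_2`, `q2` of `Letters313`, the E-letters E∘G₀∘Q\* : Z⁰ → 𝔠_E⁽¹⁾ (`hEQ`) and E∘G₀∘Dv : `bH` → 𝔠_E⁽¹⁾ (`hEDH`), `rgdH`, and (3.153)
(`E_GG_eq`): E𝔊 has the two-space sup majorant C·Lʲη·e^{−ρ′d}, C = `constD313 (B₀ + θ′·B₀(1−θc)⁻¹·c) θ′ (B₀(1−θc)⁻¹) (B₃(1−θc)⁻¹) B₃ κ_H c`, for
every ρ′ ≧ 0 with ρ′ + 3σ ≦ ρ (ρ ≦ δ₀, ρ ≦ δ₃, ρ + σ ≦ δ_K). [cite: Balaban1985BackgroundPropagators, Thm 3.13 p.426 + (3.152)–(3.153) p.426 + (3.138) p.423 + (3.42)–(3.44) pp.397–398; Balaban1984PropagatorsII, (2.54) p.232 + Lemma 2.1 (2.61) p.234] -/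
theorem GG_entry1E_of_letters (hG : GeoOK g) {𝔬 : Ops g B X Y Z W} {U : B.Cfg} {V' : Type} [Fintype V']
    {blkE : V' → g.Site} {E : (X → ℝ) →ₗ[ℝ] (V' → ℝ)} {bH : BlockNorm (toB6 g R₀ H₀) (W → ℝ)}
    {θ θ' B₀ B₃ δ₀ δ₃ δK ρ ρ' σ c : ℝ} (hrow : RowSum (toB6 g R₀ H₀) σ c) (hc : 0 ≤ c)
    (hθ : 0 ≤ θ) (hθ' : 0 ≤ θ') (hB₀ : 0 ≤ B₀) (hB₃ : 0 ≤ B₃) (hσ : 0 ≤ σ) (hρ' : 0 ≤ ρ') (hρ'ρ : ρ' + 3 * σ ≤ ρ) (hρS : ρ ≤ δ₀)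
    (hρ₃ : ρ ≤ δ₃) (hρδ : ρ + σ ≤ δK) (hq : θ * c < 1)
    (hK : HasMaj (cNorm R₀ H₀ 𝔬.blk hG.lenle 2) (cNorm R₀ H₀ 𝔬.blk hG.lenle 2) (𝔬.G0 U ∘ₗ (𝔬.Tpi U + 𝔬.T2 U))
      (fun a b => θ * Real.exp (-(δK * g.dist a b))))
    (he0 : HasMajorant (g := toB6 g R₀ H₀) 𝔬.blk (𝔬.G0 U) (fun a b => B₀ * g.len a ^ 2 * Real.exp (-(δ₀ * g.dist a b))))
    (he1E : HasMajorantHom (g := toB6 g R₀ H₀) 𝔬.blk blkE (E ∘ₗ 𝔬.G0 U)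
      (fun (a b : g.Site) => B₀ * g.len a * Real.exp (-(δ₀ * g.dist a b))))
    (hKE : HasMaj (cNorm R₀ H₀ 𝔬.blk hG.lenle 2) (cNorm R₀ H₀ blkE hG.lenle 1) (E ∘ₗ 𝔬.G0 U ∘ₗ (𝔬.Tpi U + 𝔬.T2 U))
      (fun a b => θ' * Real.exp (-(δK * g.dist a b))))
    (hEQ : HasMaj (cNorm R₀ H₀ 𝔬.blkZ hG.lenle 0) (cNorm R₀ H₀ blkE hG.lenle 1) (E ∘ₗ 𝔬.G0 U ∘ₗ 𝔬.Qstar U)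
      (fun a b => B₃ * Real.exp (-(δ₃ * g.dist a b))))
    (hEDH : HasMaj bH (cNorm R₀ H₀ blkE hG.lenle 1) (E ∘ₗ 𝔬.G0 U ∘ₗ 𝔬.Dv U) (fun a b => B₃ * Real.exp (-(δ₃ * g.dist a b))))
    (hL : Letters313 𝔬 R₀ H₀ hG B₃ δ₃ U)
    (hrgdH : HasMaj (cNorm R₀ H₀ 𝔬.blk hG.lenle 0) bH (𝔬.R U ∘ₗ 𝔬.Dvstar U ∘ₗ 𝔬.G1 U ∘ₗ LinearMap.id)
      (fun a b => B₃ * Real.exp (-(δ₃ * g.dist a b))))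
    (hI : Identities 𝔬 U) :
    HasMajorantHom (g := toB6 g R₀ H₀) 𝔬.blk blkE (E ∘ₗ 𝔬.GG U)
      (fun a b => constD313 (B₀ + θ' * (B₀ * (1 - θ * c)⁻¹) * c) θ' (B₀ * (1 - θ * c)⁻¹) (B₃ * (1 - θ * c)⁻¹) B₃ bH.κ c *
        g.len a * Real.exp (-(ρ' * g.dist a b))) := by
  -- adapted from `B9Thm313WholeLeft.GG_entry1_of_letters` (∇_U ↦ E, `D_GG_eq` ↦ `E_GG_eq`)
  have hq1 : 0 ≤ (1 - θ * c)⁻¹ := inv_nonneg.mpr (by linarith)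
  have hA₁ : 0 ≤ B₀ * (1 - θ * c)⁻¹ := mul_nonneg hB₀ hq1
  have hA₃ : 0 ≤ B₃ * (1 - θ * c)⁻¹ := mul_nonneg hB₃ hq1
  have hCL : 0 ≤ B₀ + θ' * (B₀ * (1 - θ * c)⁻¹) * c := add_nonneg hB₀ (mul_nonneg (mul_nonneg hθ' hA₁) hc)
  have hfix1 := fix_of_inverses hI.invG0' hI.invG1
  have hρ0 : 0 ≤ ρ := by linarith
  have htri : Triangle254 (toB6 g R₀ H₀) := fun a b c => hG.tri a b c
  -- (a) the right entries of G₁: G₁ : 𝔠⁽⁰⁾ → 𝔠⁽²⁾, G₁Dv : W¹ → 𝔠⁽²⁾, G₁Q* : Z⁰ → 𝔠⁽²⁾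
  have hG1 : HasMaj (cNorm R₀ H₀ 𝔬.blk hG.lenle 0) (cNorm R₀ H₀ 𝔬.blk hG.lenle 2) (𝔬.G1 U ∘ₗ LinearMap.id)
      (fun a b => B₀ * (1 - θ * c)⁻¹ * Real.exp (-(ρ * g.dist a b))) := by
    rw [LinearMap.comp_id]
    exact hasMaj_entry0_cNorm hG hrow hθ hB₀ hρ0 hρS hρδ hK he0 hfix1 hq
  have hGD := hasMaj_right_of_step hG hrow hθ hB₃ hρ0 hρ₃ hρδ hK hL.gD2 hfix1 hq
  have hGQ := hasMaj_right_of_step hG hrow hθ hB₃ hρ0 hρ₃ hρδ hK hL.gQs2 hfix1 hq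
  -- (b) the left-and-right entries EG₁ : 𝔠⁽⁰⁾ → 𝔠_E⁽¹⁾ at the rate ρ
  have h10 : HasMaj (BlockNorm.ofBlocks (toB6 g R₀ H₀) 𝔬.blk) (BlockNorm.ofBlocks (toB6 g R₀ H₀) blkE) (E ∘ₗ 𝔬.G0 U)
      (fun a b => B₀ * g.len a * Real.exp (-(δ₀ * g.dist a b))) :=
    hasMaj_of_hasMajorantHom (G := toB6 g R₀ H₀) 𝔬.blk blkE
      (fun a b => mul_nonneg (mul_nonneg hB₀ (hG.lenle a)) (Real.exp_nonneg _)) he1E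
  have hE0 : HasMaj (cNorm R₀ H₀ 𝔬.blk hG.lenle 0) (cNorm R₀ H₀ blkE hG.lenle 1) (E ∘ₗ 𝔬.G0 U ∘ₗ LinearMap.id)
      (fun a b => B₀ * Real.exp (-(δ₀ * g.dist a b))) := by
    rw [LinearMap.comp_id]
    refine (hasMaj_cNorm_of_hasMaj hG 1 0 h10).mono fun y y' => le_of_eq ?_
    have hy : g.len y ≠ 0 := (hG.lenpos y).ne'
    simp only [wt, pow_zero, pow_one, mul_one]
    rw [mul_assoc B₀, mul_comm (g.len y), ← mul_assoc B₀, mul_assoc, mul_inv_cancel₀ hy, mul_one]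
  have hD1 : HasMaj (cNorm R₀ H₀ 𝔬.blk hG.lenle 0) (cNorm R₀ H₀ blkE hG.lenle 1) (E ∘ₗ 𝔬.G1 U ∘ₗ LinearMap.id)
      (fun y y' => (B₀ + θ' * (B₀ * (1 - θ * c)⁻¹) * c) * Real.exp (-(ρ * g.dist y y'))) :=
    hasMaj_left_right hG hrow hθ' hB₀ hA₁ hρ0 hρS le_rfl hρδ hKE hE0 hG1 hfix1
  -- (c) TERM B = (EG₁Dv)(RDv*G₁) = (EG₀Dv)(RDv*G₁) + ((EG₀T₁)(G₁Dv))(RDv*G₁)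
  have hρ'₃ : ρ' ≤ δ₃ := by linarith
  have hρ'σ₃ : ρ' + σ ≤ δ₃ := by linarith
  have hB1 : HasMaj (cNorm R₀ H₀ 𝔬.blk hG.lenle 0) (cNorm R₀ H₀ blkE hG.lenle 1)
      ((E ∘ₗ 𝔬.G0 U ∘ₗ 𝔬.Dv U) ∘ₗ (𝔬.R U ∘ₗ 𝔬.Dvstar U ∘ₗ 𝔬.G1 U ∘ₗ LinearMap.id))
      (fun y y' => bH.κ * B₃ * B₃ * c * Real.exp (-(ρ' * g.dist y y'))) :=
    hasMaj_comp_exp htri hG.dnn hrow hB₃ hB₃ hρ' hρ'₃ hρ'σ₃ hEDH hrgdH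
  have hGDT : HasMaj (cNorm R₀ H₀ 𝔬.blkW hG.lenle 1) (cNorm R₀ H₀ blkE hG.lenle 1)
      ((E ∘ₗ 𝔬.G0 U ∘ₗ (𝔬.Tpi U + 𝔬.T2 U)) ∘ₗ (𝔬.G1 U ∘ₗ 𝔬.Dv U))
      (fun y y' => (cNorm R₀ H₀ 𝔬.blk hG.lenle 2 (X := X)).κ * θ' * (B₃ * (1 - θ * c)⁻¹) * c *
        Real.exp (-((ρ' + σ) * g.dist y y'))) :=
    hasMaj_comp_exp htri hG.dnn hrow hθ' hA₃ (by linarith) (by linarith) (by linarith) hKE hGD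
  simp only [cNorm_κ, one_mul] at hGDT
  have hθA₃ : 0 ≤ θ' * (B₃ * (1 - θ * c)⁻¹) * c := mul_nonneg (mul_nonneg hθ' hA₃) hc
  have hB2 : HasMaj (cNorm R₀ H₀ 𝔬.blk hG.lenle 0) (cNorm R₀ H₀ blkE hG.lenle 1)
      (((E ∘ₗ 𝔬.G0 U ∘ₗ (𝔬.Tpi U + 𝔬.T2 U)) ∘ₗ (𝔬.G1 U ∘ₗ 𝔬.Dv U)) ∘ₗ
        (𝔬.R U ∘ₗ 𝔬.Dvstar U ∘ₗ 𝔬.G1 U ∘ₗ LinearMap.id))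
      (fun y y' => (cNorm R₀ H₀ 𝔬.blkW hG.lenle 1 (X := W)).κ * (θ' * (B₃ * (1 - θ * c)⁻¹) * c) * B₃ * c *
        Real.exp (-(ρ' * g.dist y y'))) :=
    hasMaj_comp_exp htri hG.dnn hrow hθA₃ hB₃ hρ' hρ'₃ le_rfl hGDT hL.rgd2
  simp only [cNorm_κ, one_mul] at hB2
  have eB : (E ∘ₗ 𝔬.G1 U ∘ₗ 𝔬.Dv U) ∘ₗ (𝔬.R U ∘ₗ 𝔬.Dvstar U ∘ₗ 𝔬.G1 U ∘ₗ LinearMap.id) =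
      (E ∘ₗ 𝔬.G0 U ∘ₗ 𝔬.Dv U) ∘ₗ (𝔬.R U ∘ₗ 𝔬.Dvstar U ∘ₗ 𝔬.G1 U ∘ₗ LinearMap.id) +
        (((E ∘ₗ 𝔬.G0 U ∘ₗ (𝔬.Tpi U + 𝔬.T2 U)) ∘ₗ (𝔬.G1 U ∘ₗ 𝔬.Dv U)) ∘ₗ
          (𝔬.R U ∘ₗ 𝔬.Dvstar U ∘ₗ 𝔬.G1 U ∘ₗ LinearMap.id)) := by
    rw [comp_fix_left_right E (𝔬.Dv U) hfix1, LinearMap.add_comp]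
  have hB := hB1.add hB2
  rw [← eB] at hB
  -- (d) TERM C = (EG₁Q*)((QG₁Q*)⁻¹QG₁) through the sup classes Z², Z⁰
  have hQG : HasMaj (cNorm R₀ H₀ 𝔬.blk hG.lenle 0) (cNorm R₀ H₀ 𝔬.blkZ hG.lenle 2) (𝔬.Q U ∘ₗ (𝔬.G1 U ∘ₗ LinearMap.id))
      (fun a b => (cNorm R₀ H₀ 𝔬.blk hG.lenle 2 (X := X)).κ * B₃ * (B₀ * (1 - θ * c)⁻¹) * c *
        Real.exp (-((ρ' + 2 * σ) * g.dist a b))) :=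
    hasMaj_comp_exp htri hG.dnn hrow hB₃ hA₁ (by linarith) (by linarith) (by linarith) hL.q2 hG1
  simp only [cNorm_κ, one_mul] at hQG
  have hK₁ : 0 ≤ B₃ * (B₀ * (1 - θ * c)⁻¹) * c := mul_nonneg (mul_nonneg hB₃ hA₁) hc
  have hCQG : HasMaj (cNorm R₀ H₀ 𝔬.blk hG.lenle 0) (cNorm R₀ H₀ 𝔬.blkZ hG.lenle 0)
      (𝔬.C1 U ∘ₗ (𝔬.Q U ∘ₗ (𝔬.G1 U ∘ₗ LinearMap.id)))
      (fun a b => (cNorm R₀ H₀ 𝔬.blkZ hG.lenle 2 (X := Z)).κ * B₃ * (B₃ * (B₀ * (1 - θ * c)⁻¹) * c) * c *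
        Real.exp (-((ρ' + σ) * g.dist a b))) :=
    hasMaj_comp_exp htri hG.dnn hrow hB₃ hK₁ (by linarith) (by linarith) (by linarith) hL.c1_2 hQG
  simp only [cNorm_κ, one_mul] at hCQG
  have hD1Q : HasMaj (cNorm R₀ H₀ 𝔬.blkZ hG.lenle 0) (cNorm R₀ H₀ blkE hG.lenle 1) (E ∘ₗ 𝔬.G1 U ∘ₗ 𝔬.Qstar U)
      (fun y y' => (B₃ + θ' * (B₃ * (1 - θ * c)⁻¹) * c) * Real.exp (-((ρ' + σ) * g.dist y y'))) :=
    hasMaj_left_right hG hrow hθ' hB₃ hA₃ (by linarith) (by linarith) (by linarith) (by linarith) hKE hEQ hGQ hfix1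
  have hBθ : 0 ≤ B₃ + θ' * (B₃ * (1 - θ * c)⁻¹) * c := add_nonneg hB₃ hθA₃
  have hK₂ : 0 ≤ B₃ * (B₃ * (B₀ * (1 - θ * c)⁻¹) * c) * c := mul_nonneg (mul_nonneg hB₃ hK₁) hc
  have hC : HasMaj (cNorm R₀ H₀ 𝔬.blk hG.lenle 0) (cNorm R₀ H₀ blkE hG.lenle 1)
      ((E ∘ₗ 𝔬.G1 U ∘ₗ 𝔬.Qstar U) ∘ₗ (𝔬.C1 U ∘ₗ (𝔬.Q U ∘ₗ (𝔬.G1 U ∘ₗ LinearMap.id))))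
      (fun y y' => (cNorm R₀ H₀ 𝔬.blkZ hG.lenle 0 (X := Z)).κ * (B₃ + θ' * (B₃ * (1 - θ * c)⁻¹) * c) *
        (B₃ * (B₃ * (B₀ * (1 - θ * c)⁻¹) * c) * c) * c * Real.exp (-(ρ' * g.dist y y'))) :=
    hasMaj_comp_exp htri hG.dnn hrow hBθ hK₂ hρ' (by linarith) le_rfl hD1Q hCQG
  simp only [cNorm_κ, one_mul] at hC
  -- (e) assembling (3.153) with the left factor E
  have h := ((hD1.of_rate_le hG.dnn hCL (by linarith : ρ' ≤ ρ)).sub hB).sub hC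
  rw [← E_GG_eq hI E] at h
  have hC0 : 0 ≤ constD313 (B₀ + θ' * (B₀ * (1 - θ * c)⁻¹) * c) θ' (B₀ * (1 - θ * c)⁻¹) (B₃ * (1 - θ * c)⁻¹) B₃ bH.κ c :=
    constD313_nonneg hCL hθ' hA₁ hA₃ hB₃ bH.κ_nonneg hc
  have h2 : HasMaj (cNorm R₀ H₀ 𝔬.blk hG.lenle 0) (cNorm R₀ H₀ blkE hG.lenle 1) (E ∘ₗ 𝔬.GG U)
      (fun a b => constD313 (B₀ + θ' * (B₀ * (1 - θ * c)⁻¹) * c) θ' (B₀ * (1 - θ * c)⁻¹) (B₃ * (1 - θ * c)⁻¹) B₃ bH.κ c *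
        Real.exp (-(ρ' * g.dist a b))) :=
    h.mono fun a b => le_of_eq (by simp only [constD313, toB6_dist]; ring)
  have h' := hasMajorantHom_of_hasMaj_cNorm hG (fun a b => mul_nonneg hC0 (Real.exp_nonneg _)) h2
  refine hasMajorantHom_mono (g := toB6 g R₀ H₀) 𝔬.blk blkE h' fun a b => le_of_eq ?_
  simp only [wt, pow_zero, pow_one, inv_one, mul_one]
  ring

omit [Fintype P] in
/-- ★ **THEOREM 3.13, ENTRY (3.42)₂ FOR THE COMPONENT ∇_{U,ν}𝔊, PRINTED SHAPE** — `GG_entry1E_of_letters` with E := ∇_{U,ν} = `Dd U ν` (X → X):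
the E-entry of G₀ is `Thm33G0Dir.e1d ν`, the E-derivative of the step `StepDir.sDd1 ν` (constant θ_D), the E-letters `Letters313DM.dgQsd ∕ dgDHd`:
|(∇_{U,ν}𝔊λ)(x)| ≦ C·Lʲη·e^{−ρ′d(y,y′)}|λ| for x ∈ Δ(y), supp λ ⊂ Δ(y′), C = `constD313 …` as for the bundled ∇_U𝔊 (`GG_entry1_of_letters`).
[cite: Balaban1985BackgroundPropagators, Thm 3.13 p.426 + (3.153) p.426 + (3.42) p.397 + (3.39) p.397] -/
theorem GG_entry1d_of_letters (hG : GeoOK g) {𝔬 : Ops g B X Y Z W} (𝔭 : HolderProbes g B X Y PX PY)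
    {Dd Dds : B.Cfg → P → Module.End ℝ (X → ℝ)} {U : B.Cfg} {bHX : ℝ → BlockNorm (toB6 g R₀ H₀) (X → ℝ)}
    {bH : BlockNorm (toB6 g R₀ H₀) (W → ℝ)} {Bh Bi Bq : ℝ → ℝ} {Bi2 : ℝ → ℝ → ℝ}
    {θ θD θH B₀ B₃ δ₀ δ₃ δK ρ ρ' σ c : ℝ} (hrow : RowSum (toB6 g R₀ H₀) σ c) (hc : 0 ≤ c)
    (hθ : 0 ≤ θ) (hθD : 0 ≤ θD) (hB₀ : 0 ≤ B₀) (hB₃ : 0 ≤ B₃) (hσ : 0 ≤ σ) (hρ' : 0 ≤ ρ') (hρ'ρ : ρ' + 3 * σ ≤ ρ) (hρS : ρ ≤ δ₀)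
    (hρ₃ : ρ ≤ δ₃) (hρδ : ρ + σ ≤ δK) (hq : θ * c < 1)
    (hK : HasMaj (cNorm R₀ H₀ 𝔬.blk hG.lenle 2) (cNorm R₀ H₀ 𝔬.blk hG.lenle 2) (𝔬.G0 U ∘ₗ (𝔬.Tpi U + 𝔬.T2 U))
      (fun a b => θ * Real.exp (-(δK * g.dist a b))))
    (he0 : HasMajorant (g := toB6 g R₀ H₀) 𝔬.blk (𝔬.G0 U) (fun a b => B₀ * g.len a ^ 2 * Real.exp (-(δ₀ * g.dist a b))))
    (hH0 : Thm33G0Dir 𝔬 𝔭 Dd Dds R₀ H₀ bHX B₀ Bh Bi Bi2 δ₀ U)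
    (hSD : StepDir 𝔬 𝔭 Dd Dds R₀ H₀ bHX hG.lenle θD θH δK U)
    (hL : Letters313 𝔬 R₀ H₀ hG B₃ δ₃ U) (hLD : Letters313D 𝔬 R₀ H₀ hG B₃ δ₃ bH U)
    (hLDM : Letters313DM 𝔬 𝔭 Dd R₀ H₀ hG B₃ Bq δ₃ bH U) (hI : Identities 𝔬 U) (ν : P) :
    HasMajorantHom (g := toB6 g R₀ H₀) 𝔬.blk 𝔬.blk (Dd U ν ∘ₗ 𝔬.GG U)
      (fun a b => constD313 (B₀ + θD * (B₀ * (1 - θ * c)⁻¹) * c) θD (B₀ * (1 - θ * c)⁻¹) (B₃ * (1 - θ * c)⁻¹) B₃ bH.κ c *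
        g.len a * Real.exp (-(ρ' * g.dist a b))) :=
  GG_entry1E_of_letters hG hrow hc hθ hθD hB₀ hB₃ hσ hρ' hρ'ρ hρS hρ₃ hρδ hq hK he0 (hH0.e1d ν) (hSD.sDd1 ν) (hLDM.dgQsd ν)
    (hLDM.dgDHd ν) hL hLD.rgdH hI

/-! ## §3 The mixed L² member of 𝔊 on the direction-pair family -/

omit [Fintype P] in
/-- ★ **(3.46), THE MIXED MEMBER FOR 𝔊 = 𝔓G₁ PER DIRECTION PAIR, AS A BLOCK-L² BOUND** — ‖1_{Δ(y)}∇_{U,ν}𝔊∇\*_{U,μ}f‖₂ ≦ K·e^{−ρd(y,y′)}‖f‖₂ for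
supp f ⊂ Δ(y′): (3.153) with E = ∇_{U,ν}, F = ∇\*_{U,μ} (`E_GG_F_eq`), the G₁-entries ∇_νG₁∇\*_μ, ∇_νG₁Dv, ∇_νG₁Q\*, G₁∇\*_μ by r1's Neumann bookkeeping from
Theorem 3.3 for G₀ per direction (`Thm33G0L2M.l1d ∕ l2d ∕ l4m` + the letters `gDv ∕ gQs` and `Letters313L2M.dGDvd ∕ dGQsd`) and the step
(`entry_l2w_of_step`), the letters RDv\*G₁∇\*_μ (`rgdDd`), C₁, Q (`Letters313L2P`), composed by `hasMaj_frakG_classes` in the block-L² classes (all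
cutting costs 1) with [4] (2.61) as the row sum; provisos ρ + 5σ ≦ δ, B₂θc² < 1; K = `constG46 (constKp B₂ B₄ θ c) c` — the per-pair twin of
`B9Thm313WholeL2G.GG_l2bd_entry4` (there for the bundled ∇_U𝔊∇\*_U on the lattice Y).
[cite: Balaban1985BackgroundPropagators, Thm 3.13 p.426 + (3.153) p.426 + (3.46) p.398 + (3.39) p.397 + Thm 3.12 p.423; Balaban1984PropagatorsII, Lemma 2.1 (2.61) p.234] -/
theorem GG_l2bd_mixed_of_letters (hG : GeoOK g) {𝔬 : Ops g B X Y Z W} {Dd Dds : B.Cfg → P → Module.End ℝ (X → ℝ)} {U : B.Cfg}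
    {B₂ B₄ θ δ ρ σ c : ℝ} (hrow : RowSum (toB6 g R₀ H₀) σ c) (hB₂ : 0 ≤ B₂) (hB₄ : 0 ≤ B₄) (hθ : 0 ≤ θ) (hρ : 0 ≤ ρ)
    (hσ : 0 ≤ σ) (hρδ : ρ + 5 * σ ≤ δ) (hL : Thm33G0L2M 𝔬 Dd Dds R₀ H₀ B₂ δ U)
    (hT : BlockBd (g := toB6 g R₀ H₀) 𝔬.blk 𝔬.blk (𝔬.Tpi U + 𝔬.T2 U)
      (fun (y y' : g.Site) => θ * (g.len y)⁻¹ * (g.len y')⁻¹ * Real.exp (-(δ * g.dist y y'))))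
    (hLt : Letters313L2P 𝔬 Dd Dds R₀ H₀ B₄ δ U) (hLM : Letters313L2M 𝔬 Dd Dds R₀ H₀ B₄ δ U) (hI : Identities 𝔬 U)
    (hq : B₂ * θ * c * c < 1) (ν μ : P) :
    BlockBd (g := toB6 g R₀ H₀) 𝔬.blk 𝔬.blk (Dd U ν ∘ₗ (𝔬.GG U ∘ₗ Dds U μ))
      (fun (y y' : g.Site) => constG46 (constKp B₂ B₄ θ c) c * Real.exp (-(ρ * g.dist y y'))) := by
  -- adapted from `B9Thm313WholeL2G.GG_l2bd_entry4` (∇_U ↦ ∇_{U,ν}, ∇\*_U ↦ ∇\*_{U,μ}, lattice Y ↦ X)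
  have hc : 0 ≤ c ∨ IsEmpty g.Site := by
    by_cases hne : Nonempty g.Site
    · exact Or.inl (hrow.nonneg hne.some)
    · exact Or.inr (not_nonempty_iff.mp hne)
  rcases hc with hc | hemp
  swap
  · intro y' μ' hμ y
    exact (hemp.false y).elim
  have htri : Triangle254 (toB6 g R₀ H₀) := fun a b c => hG.tri a b c
  have hW1 : ∀ y : g.Site, 0 < (fun _ : g.Site => (1 : ℝ)) y := fun _ => one_pos
  have hWl : ∀ y : g.Site, 0 < (fun y : g.Site => g.len y) y := fun y => hG.lenpos y
  have hWi : ∀ y : g.Site, 0 < (fun y : g.Site => (g.len y)⁻¹) y := fun y => inv_pos.mpr (hG.lenpos y)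
  have hfix : 𝔬.G1 U = 𝔬.G0 U + 𝔬.G0 U ∘ₗ (𝔬.Tpi U + 𝔬.T2 U) ∘ₗ 𝔬.G1 U := fix_of_inverses hI.invG0' hI.invG1
  have hLap : Thm33G0L2 𝔬 (fun _ => (0 : Module.End ℝ (X → ℝ))) R₀ H₀ B₂ δ U := Thm33G0L2P.toLap hB₂ hG.lenle hL.toThm33G0L2P
  -- constants
  have hS0 : 0 ≤ B₂ + B₄ := add_nonneg hB₂ hB₄
  have hS₂ : B₂ ≤ B₂ + B₄ := by linarith
  have hS₄ : B₄ ≤ B₂ + B₄ := by linarith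
  obtain ⟨hKp0, -⟩ := constP_nonneg_le hθ hc hq hS0 hS0 hS0 le_rfl le_rfl le_rfl
  obtain ⟨hP₂0, hP₂le⟩ := constP_nonneg_le hθ hc hq hB₂ hB₂ hB₂ hS₂ hS₂ hS₂
  obtain ⟨hP₄0, hP₄le⟩ := constP_nonneg_le hθ hc hq hB₄ hB₂ hB₄ hS₄ hS₂ hS₄
  have hB₄K : B₄ ≤ constP B₂ θ c (B₂ + B₄) (B₂ + B₄) (B₂ + B₄) := by
    have hq1 : 0 ≤ (1 - B₂ * θ * c * c)⁻¹ := inv_nonneg.mpr (by linarith)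
    have h0 : 0 ≤ (B₂ + B₄) * (θ * ((B₂ + B₄) * (1 - B₂ * θ * c * c)⁻¹) * c) * c :=
      mul_nonneg (mul_nonneg hS0 (mul_nonneg (mul_nonneg hθ (mul_nonneg hS0 hq1)) hc)) hc
    unfold constP; linarith
  have hKK0 : 0 ≤ constP B₂ θ c (B₂ + B₄) (B₂ + B₄) (B₂ + B₄) * constP B₂ θ c (B₂ + B₄) (B₂ + B₄) (B₂ + B₄) * c :=
    mul_nonneg (mul_nonneg hKp0 hKp0) hc
  -- rates
  have hr₁0 : 0 ≤ ρ + 3 * σ := by linarith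
  have hr₁δ : ρ + 3 * σ + 2 * σ ≤ δ := by linarith
  have hr₂0 : 0 ≤ ρ + 2 * σ := by linarith
  have hr₂1 : ρ + 2 * σ ≤ ρ + 3 * σ := by linarith
  have hr₂δ' : ρ + 2 * σ + σ ≤ δ := by linarith
  have hr₂δ : ρ + 2 * σ ≤ δ := by linarith
  have hρr₂ : ρ + 2 * σ ≤ ρ + 2 * σ := le_rfl
  -- the G₁-entries ∇_νG₁∇*_μ, ∇_νG₁Dv, ∇_νG₁Q*, G₁∇*_μ by r1's Neumann bookkeeping, at the rate ρ + 3σ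
  have pG := entry_l2w_of_step hG hW1 hW1 (Eop := Dd U ν) (Fop := Dds U μ) (aS := B₂) (aE := B₂) (aEF := B₂) hrow hB₂ hθ
    hB₂ hB₂ hB₂ hr₁0 hσ hr₁δ hLap hT ((hL.l2d μ).mono fun y y' => le_of_eq (by ring))
    ((hL.l1d ν).mono fun y y' => le_of_eq (by ring)) ((hL.l4m (ν, μ)).mono fun y y' => le_of_eq (by ring)) hfix hq
  have pGD := entry_l2w_of_step hG hW1 hW1 (Eop := Dd U ν) (Fop := 𝔬.Dv U) (aS := B₄) (aE := B₂) (aEF := B₄) hrow hB₂ hθ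
    hB₄ hB₂ hB₄ hr₁0 hσ hr₁δ hLap hT (hLt.gDv.mono fun y y' => le_of_eq (by ring)) ((hL.l1d ν).mono fun y y' => le_of_eq (by ring))
    ((hLM.dGDvd ν).mono fun y y' => le_of_eq (by ring)) hfix hq
  have pGQ := entry_l2w_of_step hG hWl hW1 (Eop := Dd U ν) (Fop := 𝔬.Qstar U) (aS := B₄) (aE := B₂) (aEF := B₄) hrow hB₂ hθ
    hB₄ hB₂ hB₄ hr₁0 hσ hr₁δ hLap hT (hLt.gQs.mono fun y y' => le_of_eq (by ring)) ((hL.l1d ν).mono fun y y' => le_of_eq (by ring))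
    ((hLM.dGQsd ν).mono fun y y' => le_of_eq (by ring)) hfix hq
  have pGDs := entry_l2w_of_step hG hW1 hWi (Eop := LinearMap.id) (Fop := Dds U μ) (aS := B₂) (aE := B₂) (aEF := B₂) hrow
    hB₂ hθ hB₂ hB₂ hB₂ hr₁0 hσ hr₁δ hLap hT ((hL.l2d μ).mono fun y y' => le_of_eq (by ring))
    (by rw [LinearMap.id_comp]; exact hL.l0.mono fun y y' => le_of_eq (by rw [inv_inv]; ring))
    (by rw [LinearMap.id_comp]; exact (hL.l2d μ).mono fun y y' => le_of_eq (by rw [inv_inv]; ring)) hfix hq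
  rw [LinearMap.id_comp] at pGDs
  -- the letters RDv*G₁∇*_μ, C₁, Q in the block-L² classes
  have pRG : HasMaj (l2w (toB6 g R₀ H₀) 𝔬.blk (fun _ : g.Site => (1 : ℝ)) fun y => (hW1 y).le)
      (l2w (toB6 g R₀ H₀) 𝔬.blkW (fun _ : g.Site => (1 : ℝ)) fun y => (hW1 y).le)
      (𝔬.R U ∘ₗ 𝔬.Dvstar U ∘ₗ 𝔬.G1 U ∘ₗ Dds U μ) (fun y y' => B₄ * Real.exp (-(δ * g.dist y y'))) :=
    hasMaj_l2w_of_blockBd_ratio (g := toB6 g R₀ H₀) hW1 hW1 ((hLM.rgdDd μ).mono fun y y' => le_of_eq (by ring))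
  have pC : HasMaj (l2w (toB6 g R₀ H₀) 𝔬.blkZ (fun y : g.Site => (g.len y)⁻¹) fun y => (hWi y).le)
      (l2w (toB6 g R₀ H₀) 𝔬.blkZ (fun y : g.Site => g.len y) fun y => (hWl y).le)
      (𝔬.C1 U) (fun y y' => B₄ * Real.exp (-(δ * g.dist y y'))) :=
    hasMaj_l2w_of_blockBd_ratio (g := toB6 g R₀ H₀) hWi hWl (hLt.c1.mono fun y y' => le_of_eq (by ring))
  have pQ : HasMaj (l2w (toB6 g R₀ H₀) 𝔬.blk (fun y : g.Site => (g.len y)⁻¹) fun y => (hWi y).le)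
      (l2w (toB6 g R₀ H₀) 𝔬.blkZ (fun y : g.Site => (g.len y)⁻¹) fun y => (hWi y).le)
      (𝔬.Q U) (fun y y' => B₄ * Real.exp (-(δ * g.dist y y'))) :=
    hasMaj_l2w_of_blockBd_ratio (g := toB6 g R₀ H₀) hWi hWi (hLt.q.mono fun y y' => le_of_eq (by rw [inv_inv]; ring))
  -- QG₁∇*_μ at the rate ρ + 2σ
  have pQG := hasMaj_comp_exp htri hG.dnn hrow hB₄ hP₂0 hr₂0 hr₂1 hr₂δ' pQ pGDs
  simp only [l2w_κ, one_mul] at pQG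
  -- everything at (K_p, ρ + 2σ), the composite at K_p²c
  have uG := hasMaj_up hG hP₂0 hP₂le hr₂1 pG
  have uGD := hasMaj_up hG hP₄0 hP₄le hr₂1 pGD
  have uRG := hasMaj_up hG hB₄ hB₄K hr₂δ pRG
  have uGQ := hasMaj_up hG hP₄0 hP₄le hr₂1 pGQ
  have uC := hasMaj_up hG hB₄ hB₄K hr₂δ pC
  have uQG := hasMaj_up hG (mul_nonneg (mul_nonneg hB₄ hP₂0) hc)
    (mul_le_mul_of_nonneg_right (mul_le_mul hB₄K hP₂le hP₂0 hKp0) hc) hρr₂ pQG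
  -- (3.153) composed in the block-L² classes
  have hfr := hasMaj_frakG_classes htri hG.dnn hrow hKp0 hKp0 hKp0 hKp0 hKp0 hKK0 hρ hσ hρr₂ uG uGD uRG uGQ uC uQG
  have hGG := hfr.congr (T' := Dd U ν ∘ₗ (𝔬.GG U ∘ₗ Dds U μ)) fun f => by rw [E_GG_F_eq hI (Dd U ν) (Dds U μ)]
  have hbd := blockBd_of_hasMaj_l2w hGG hW1
  refine hbd.mono fun y y' => le_of_eq ?_
  simp only [l2w_κ, one_mul, toB6_dist, constG46, constKp, mul_one, div_one]

/-- ★ **(3.46)₃ OF THE RECORD (THE MIXED MEMBER) FOR 𝔊 AS THE PACKAGED PAIR FAMILY ∇_{U,ν}𝔊∇\*_{U,μ}** — one model X → X × (P × P) with block map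
`blk ∘ Prod.fst` (n06-k's `familyOp`, the species of the v4 face's `hl3`), block bound √|P × P|·K·e^{−ρd(y,y′)}: `GG_l2bd_mixed_of_letters` for
every pair, then `blockBd_familyOp` ((3.39): *"max_{μ,ν}"* is dominated by the packaged family).
[cite: Balaban1985BackgroundPropagators, Thm 3.13 p.426 + (3.46) p.398 + (3.39) p.397; Balaban1984PropagatorsII, Lemma 2.1 p.234] -/
theorem GG_l2bd_mixedFamily_of_letters (hG : GeoOK g) {𝔬 : Ops g B X Y Z W} {Dd Dds : B.Cfg → P → Module.End ℝ (X → ℝ)} {U : B.Cfg}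
    {B₂ B₄ θ δ ρ σ c : ℝ} (hrow : RowSum (toB6 g R₀ H₀) σ c) (hc : 0 ≤ c) (hB₂ : 0 ≤ B₂) (hB₄ : 0 ≤ B₄) (hθ : 0 ≤ θ) (hρ : 0 ≤ ρ)
    (hσ : 0 ≤ σ) (hρδ : ρ + 5 * σ ≤ δ) (hL : Thm33G0L2M 𝔬 Dd Dds R₀ H₀ B₂ δ U)
    (hT : BlockBd (g := toB6 g R₀ H₀) 𝔬.blk 𝔬.blk (𝔬.Tpi U + 𝔬.T2 U)
      (fun (y y' : g.Site) => θ * (g.len y)⁻¹ * (g.len y')⁻¹ * Real.exp (-(δ * g.dist y y'))))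
    (hLt : Letters313L2P 𝔬 Dd Dds R₀ H₀ B₄ δ U) (hLM : Letters313L2M 𝔬 Dd Dds R₀ H₀ B₄ δ U) (hI : Identities 𝔬 U)
    (hq : B₂ * θ * c * c < 1) :
    BlockBd (g := toB6 g R₀ H₀) 𝔬.blk (𝔬.blk ∘ Prod.fst) (familyOp (fun q : P × P => Dd U q.1 ∘ₗ (𝔬.GG U ∘ₗ Dds U q.2)))
      (fun (y y' : g.Site) => Real.sqrt (Fintype.card (P × P)) * (constG46 (constKp B₂ B₄ θ c) c *
        Real.exp (-(ρ * g.dist y y')))) := by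
  have hS0 : 0 ≤ B₂ + B₄ := add_nonneg hB₂ hB₄
  have hKp0 : 0 ≤ constKp B₂ B₄ θ c := (constP_nonneg_le hθ hc hq hS0 hS0 hS0 le_rfl le_rfl le_rfl).1
  have hK0 : 0 ≤ constG46 (constKp B₂ B₄ θ c) c := constG46_nonneg hKp0 hc
  exact blockBd_familyOp (R := R₀) (H := H₀) 𝔬.blk 𝔬.blk
    (fun a b => mul_nonneg hK0 (Real.exp_nonneg _))
    fun q => GG_l2bd_mixed_of_letters hG hrow hB₂ hB₄ hθ hρ hσ hρδ hL hT hLt hLM hI hq q.1 q.2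

end OneMember

end

end Literature.MathematicalPhysics.QuantumFieldTheory.Balaban1983to89.B9Thm313WholeDir
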